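import Summits.BirchSwinnertonDyer.Rank1Residual.P2.CongruentNumberSilentEvenFiveEnclosureDescent
import Literature.NumberTheory.EllipticCurves.Tian2014.CMPointSystemGaloisGeneration
import HarnessLib

/-!
# Cell `bsd-monsky` (typer), route A: C-P2-1 on `𝒮⁻` from the REDUCED aut system display ALONE — the corner of record
# (`…_of_autSystem_descent (hSys⁷)`, referee B ROUND 681) with ONE printed sentence fewer in its displayed hypothesis

HONEST FRAMING (cell `bsd-monsky`, run/shared/lean/pub/bsd-monsky/; README §1): ONE theorem on ONE explicit infinite
family of quadratic twists of the congruent number curve at the prime `2`; not "BSD for rank ≤ 1", nothing at odd primes;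
nothing is booked by this file. The corner of record of route A (referee B ROUND 681, 2026-08-27T10:21Z) is
`congruentSilentEvenFiveBSDTwo_of_autSystem_descent (hSys⁷ : tian2014_system_sMinus_aut)`, relative to the ONE
displayed fact `hSys⁷`. An idle-conjunct audit of that display (`Literature/…/Tian2014/CMPointSystemGaloisGeneration.lean`)
found exactly one displayed printed sentence that no kernel theorem of the chain consumes — Tian's Prop. 4.6 generation
sentence «`Gal(H(i)/ℚ)` is generated by `Gal(H(i)/K(i))`, the complex conjugation, and the operator `σ_{1+ϖ}`» — and
proved it from the other displayed Galois facts; `tian2014_system_sMinus_autReduced` is `hSys⁷` without that sentence,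
and the two facts are EQUIVALENT in the kernel (`tian2014_system_sMinus_aut_iff_autReduced`). This file is the corner on
the reduced display: `congruentSilentEvenFiveBSDTwo_of_autSystemReduced_descent (hSys⁸ : tian2014_system_sMinus_autReduced)`
— the `2`-Selmer input the tree's complete `2`-descent (`#Sel⁽²⁾(E_{2pq}/ℚ) ≤ 8`, p480559), rank one the tree's first
`2`-descent (p457453 / p458378) — with the rank axis, clause (a) and both typed forms from the same binder. Marks of record
untouched (the readings P `tyzPhiParam` and M5 `tyzZN` sit inside `GrossZagierAut`, displayed verbatim as before).
CONDITIONAL on the one (reduced) system display; nothing asserted; the conjecture `Prop`s stay `@[conjecture]`.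
[cite: Tian2014, Thm. 2.8 (J132), Def. 2.7, Prop. 2.1, p0003 L3–L5 (J119), J124–J126, §4.2 (p0022 L52–L60), Prop. 4.6 proof (p0023 L26–L28)]
[cite: TianYuanZhang2017, Thm. 3.3 (p. 739), p. 749, J733, J741, J747, J751, Lemma 3.16 (J754)]
[cite: SilvermanAEC2009, Prop. X.1.4, Prop. X.4.9, Thm. X.4.2] [cite: Miller2011LMS, Def. 1.1 (arXiv:1010.2431 p. 3)]
[cite: Lagrange1975, §11 table p. 16-12]
-/

noncomputable section

open scoped Classical

open WeierstrassCurve Literature.NumberTheory.EllipticCurves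
  Literature.NumberTheory.EllipticCurves.Rank1Residual.Typed

set_option autoImplicit false

namespace Summit.BirchSwinnertonDyer.Rank1Residual.P2

open Conjectures Literature.NumberTheory.EllipticCurves.Tian2014

/-! ## §1 C-P2-1 on `𝒮⁻` from the reduced aut display ALONE -/

/-- **C-P2-1 = Theorem 1.1 on `𝒮⁻` from the REDUCED aut system display `hSys⁸` ALONE** — the corner of record
(`…_of_autSystem_descent (hSys⁷)`, ROUND 681) with Tian's Prop. 4.6 generation sentence struck from the displayed
hypothesis (it is a kernel theorem of the remaining Galois facts); the `2`-Selmer input is the tree's complete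
`2`-descent. CONDITIONAL on the one reduced system display; nothing asserted.
[cite: Tian2014, Thm. 2.8 (J132), Def. 2.7, Prop. 2.1, p0003 L3–L5 (J119), J124–J126, Prop. 4.6 proof (p0023 L26–L28)]
[cite: TianYuanZhang2017, Thm. 3.3 (p. 739), p. 749, J733, J741, J747, J751, Lemma 3.16 (J754)]
[cite: SilvermanAEC2009, Prop. X.1.4, Prop. X.4.9, Thm. X.4.2] [cite: Miller2011LMS, Def. 1.1 (arXiv:1010.2431 p. 3)] -/
theorem congruentSilentEvenFiveBSDTwo_of_autSystemReduced_descent (hSys : tian2014_system_sMinus_autReduced) :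
    CongruentSilentEvenFiveBSDTwo :=
  congruentSilentEvenFiveBSDTwo_of_autSystem_descent (tian2014_system_sMinus_aut_of_autReduced hSys)

/-! ## §2 The rank axis and the sharper form from the reduced aut display ALONE -/

/-- **C-P2-1, SHARPER (`Ш_an`-unit) FORM, from the reduced aut system display ALONE** (`hSys⁸`): clause (a) and
`#Ш_an(E_{2pq})` a `2`-adic unit on all of `𝒮⁻` with NO `2`-Selmer input (the first `2`-descent of Lagrange 1975 in the
kernel and the system's own point). CONDITIONAL; nothing asserted.
[cite: Tian2014, Def. 2.7, Prop. 2.1, p0003 L3–L5 (J119), J124–J126, Prop. 4.6 proof (p0023 L26–L28)]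
[cite: TianYuanZhang2017, Thm. 3.3, J733, J741, J747, J751, Lemma 3.16 (J754)] [cite: Lagrange1975, §11 table p. 16-12] -/
theorem congruentSilentEvenFiveOrdTwo_of_autSystemReduced_rankDescent (hSys : tian2014_system_sMinus_autReduced) :
    CongruentSilentEvenFiveOrdTwo :=
  congruentSilentEvenFiveOrdTwo_of_autSystem_rankDescent (tian2014_system_sMinus_aut_of_autReduced hSys)

/-- **Clause (a) on all of `𝒮⁻` from the reduced aut system display alone**: `ord_{s=1} L(E_{2pq}, s) = 1`.
[cite: TianYuanZhang2017, Thm. 1.1, Thm. 3.3] [cite: Tian2014, Prop. 4.6 proof (p0023 L26–L28)] [cite: Lagrange1975, §11 table p. 16-12] -/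
theorem analyticRank_eq_one_of_autSystemReduced_rankDescent (hSys : tian2014_system_sMinus_autReduced) :
    ∀ p q : ℕ, p.Prime → q.Prime → p % 8 = 5 → q % 4 = 3 → jacobiSym p q = -1 →
      (congruentNumberCurve (2 * (p * q))).analyticRank = 1 :=
  analyticRank_eq_one_of_autSystem_rankDescent (tian2014_system_sMinus_aut_of_autReduced hSys)

/-- **Rank one on all of `𝒮⁻` from the reduced aut system display alone.** [cite: Lagrange1975, §11 table p. 16-12]
[cite: Monsky1990MockHeegner, Thm. 5.5 (p. 62), Thm. 5.9 (1) (pp. 63–64)] [cite: Tian2014, Prop. 4.6 proof (p0023 L26–L28)] -/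
theorem mordellWeilRank_eq_one_of_autSystemReduced_rankDescent (hSys : tian2014_system_sMinus_autReduced) :
    ∀ p q : ℕ, p.Prime → q.Prime → p % 8 = 5 → q % 4 = 3 → jacobiSym p q = -1 →
      (congruentNumberCurve (2 * (p * q))).mordellWeilRank = 1 :=
  mordellWeilRank_eq_one_of_autSystem_rankDescent (tian2014_system_sMinus_aut_of_autReduced hSys)

/-- **Both typed forms of C-P2-1 on `𝒮⁻` from the reduced aut display ALONE.** CONDITIONAL; nothing asserted.
[cite: Tian2014, Def. 2.7, Prop. 2.1, p0003 L3–L5 (J119), J124–J126, Prop. 4.6 proof (p0023 L26–L28)]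
[cite: TianYuanZhang2017, Thm. 3.3, J733, J741, J747, J751, Lemma 3.16 (J754)]
[cite: SilvermanAEC2009, Prop. X.1.4, Prop. X.4.9] [cite: Miller2011LMS, Def. 1.1] -/
theorem congruentSilentEvenFive_pair_of_autSystemReduced_descent (hSys : tian2014_system_sMinus_autReduced) :
    CongruentSilentEvenFiveOrdTwo ∧ CongruentSilentEvenFiveBSDTwo :=
  ⟨congruentSilentEvenFiveOrdTwo_of_autSystemReduced_rankDescent hSys,
    congruentSilentEvenFiveBSDTwo_of_autSystemReduced_descent hSys⟩

/-! ## §3 The two corners are interchangeable (the displayed facts are equivalent in the kernel) -/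

/-- **The corner of record and the reduced corner are the same theorem read through equivalent displays**: C-P2-1 follows
from `hSys⁷` iff it follows from `hSys⁸`, because `hSys⁷ ⟺ hSys⁸` (`tian2014_system_sMinus_aut_iff_autReduced`).
[cite: Tian2014, Prop. 4.6 proof (p0023 L26–L28), §4.2 (p0022 L52–L60)] -/
theorem autSystem_imp_bsdTwo_iff_autSystemReduced_imp_bsdTwo :
    (tian2014_system_sMinus_aut → CongruentSilentEvenFiveBSDTwo) ↔
      (tian2014_system_sMinus_autReduced → CongruentSilentEvenFiveBSDTwo) :=
  ⟨fun h hR => h (tian2014_system_sMinus_aut_of_autReduced hR),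
    fun h hA => h (tian2014_system_sMinus_autReduced_of_aut hA)⟩

end Summit.BirchSwinnertonDyer.Rank1Residual.P2

end
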